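import Summits.BirchSwinnertonDyer.BirchSwinnertonDyer.Theses.GenusKolyvaginAtTwo
import Summits.BirchSwinnertonDyer.BirchSwinnertonDyer.Theorems.CMKolyvaginAtInertTwoCMExactDescentAtTwoGeneral
import Literature.NumberTheory.EllipticCurves.MordellWeilRankZeroProofs

/-!
# Route `GenusKolyvaginAtTwo`, crux `ExactDescentAtTwo` (item stmt-BirchSwinnertonDyer-22138):
# the crux closed modulo FOUR published facts — Kolyvagin's theorem over `K` is not an input

HONEST FRAMING (cell `bsd-f1-sign2`, seat `bsd-line-gk2-p3`, gen 2; D-0145 line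
`route-BirchSwinnertonDyer-GenusKolyvaginAtTwo`, rev 2, leaf K4 `Rank1Residual.NonCMAtTwo`):
THEOREMS ONLY — no definition, no named fact, nothing asserted; BSD is not proved by this and no
class of WALL row 1 is closed here. The landed five-fact closer
`GenusExactDescent.exactDescentAtTwo_of_facts` (`…ExactDescentAtTwoOfFacts.lean`, p583915) consumes
Kolyvagin's theorem (`kolyvagin`: `y_K` non-torsion ⟹ `rank E(K) = 1`) only to see that the twin
`Wd ≅ E^{(d_K)}` of the rank-zero member has analytic rank EXACTLY one. The item's OWN binders force
this without Kolyvagin: the Heegner point `P₀ ∈ E(K)` below `P(1)` is non-torsion, so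
`rank E(K) ≥ 1`; GZK at `r_an(E) = 0` gives `rank E(ℚ) = 0`, so `rank E^{(d_K)}(ℚ) = rank E(K) ≥ 1`
(`mordellWeilRank_baseChange_quadratic_holds`); the descent count
`#Sel₂(Wd) = 2^{rank} · #Wd(ℚ)[2] · #Ш[2]` (Silverman AEC X.4.2; tree `natCard_selmerGroup_eq`) with
`#Sel₂(Wd) = 2` gives `rank Wd ≤ 1`; hence `rank Wd = 1`, and clause (i) of `BSD(Wd, 2)` (Miller
Def. 1.1) gives `r_an(Wd) = 1`. The CM-free, rank-order-symmetric exact descent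
`CMExactDescent.bsdp_two_of_card_sha_baseChange_eq_of_facts_rankZero`
(`…CMKolyvaginAtInertTwoCMExactDescentAtTwoGeneral.lean`, p582452: `ord₂ #Ш_an(W ⊗ K) = 2M₀ =
ord₂ #Ш(W ⊗ K)` from Gross–Zagier over `K`, then Milne's model-free descent) concludes `BSD(W, 2)`.

NET: **`exactDescentAtTwo_of_four_facts : GZ(N_E, W, K) ∀(W,K) → GZK → modularity → Milne →
ExactDescentAtTwo`** and the bundle `exactDescentAtTwo_ofFourFacts`, whose antecedent is VERBATIM
the four-fact antecedent of the CM sibling's `CMExactDescent.cmExactDescentAtTwo_ofFacts` (item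
22837) — one `…OfFacts` antecedent serves both routes' descent cruxes; the binders `#Sel₂(Wd) = 2`
and `BSD(Wd, 2)` of the item are USED (only `¬ W.HasCM` and the optimality display of `Dt` stay
idle). CONDITIONAL (D-0014): closes item 22138 only through an `…OfFacts` twin item (planner).
This module imports the CM sibling's Theorems file for the shared descent (dedup forbids
re-proving it here); a `theses-cone` warning is accepted for it, as for p583915/p584986.

References: [GrossZagier1986] V.§2; [GrossLMS1991] §2 (2.2), §4; [McCallumLMS1991] §5 Lemma 5.1;
[Milne1972ArithmeticAV] §1 Thm 1; [Miller2011LMS] Def. 1.1; [SilvermanAEC2009] VIII.6.7, X.4.2;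
[Darmon2004] Thm. 3.22.
-/

set_option autoImplicit false
-- the Theorems namespace of this sub repeats the summit name by design (D-0017 nested layout)
set_option linter.dupNamespace false

noncomputable section

open scoped Classical

open WeierstrassCurve NumberField Literature.NumberTheory.EllipticCurves
  Literature.NumberTheory.EllipticCurves.ModularForms
  Literature.NumberTheory.EllipticCurves.KrizLi2019
  Summit.BirchSwinnertonDyer.BirchSwinnertonDyer.Theorems.CMExactDescent

namespace Summit.BirchSwinnertonDyer.BirchSwinnertonDyer.Theorems.GenusExactDescent

/-- **`#Sel₂(W') = 2` bounds the rank by one**: from the exact descent count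
`#Sel^{(2)}(W'/ℚ) = 2^{rank} · #W'(ℚ)[2] · #(Ш ⊓ H¹(ℚ,W')[2])` (Silverman AEC X.4.2(a); tree theorem
`WeierstrassCurve.natCard_selmerGroup_eq`), `2^{rank} ∣ 2`. Unconditional.
[cite: SilvermanAEC2009, Thm. X.4.2(a)] -/
theorem mordellWeilRank_le_one_of_card_selmerGroup_two (W' : WeierstrassCurve ℚ) [W'.IsElliptic]
    (hSel : Nat.card (W'.selmerGroup 2) = 2) : W'.mordellWeilRank ≤ 1 := by
  have hcard := W'.natCard_selmerGroup_eq (n := 2) two_ne_zero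
  simp only [Nat.cast_ofNat] at hcard
  rw [hSel, mul_assoc] at hcard
  have hdvd : 2 ^ W'.mordellWeilRank ∣ 2 ^ 1 := by
    rw [pow_one]
    exact Dvd.intro _ hcard.symm
  exact (Nat.pow_dvd_pow_iff_le_right one_lt_two).mp hdvd

/-- **A non-torsion point gives positive rank**: if `E(F)` has a point of infinite order then
`E(F)` is infinite (its multiples are pairwise distinct, Mathlib `infinite_not_isOfFinAddOrder`),
so `rank E(F) ≥ 1` (`mordellWeilRank_eq_zero_iff_finite`, Silverman AEC VIII.6.7).
[cite: SilvermanAEC2009, Thm. VIII.6.7] -/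
theorem one_le_mordellWeilRank_of_not_isOfFinAddOrder {F : Type} [Field F] [NumberField F]
    (W' : WeierstrassCurve F) [W'.IsElliptic] {P : W'.toAffine.Point} (hP : ¬ IsOfFinAddOrder P) :
    1 ≤ W'.mordellWeilRank := by
  have hinf : Infinite W'.toAffine.Point :=
    Set.infinite_univ_iff.mp ((infinite_not_isOfFinAddOrder hP).mono (Set.subset_univ _))
  refine Nat.one_le_iff_ne_zero.mpr fun h0 ↦ ?_
  haveI : Finite W'.toAffine.Point := W'.mordellWeilRank_eq_zero_iff_finite.mp h0
  exact not_finite W'.toAffine.Point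

/-- **The twin's analytic rank is EXACTLY one, from the item's binders and GZK alone** (no
Kolyvagin). `W/ℚ` globally minimal with `r_an(E) = 0`; `K` quadratic (`[K:ℚ] = 2`); `P₀ ∈ E(K)` of
infinite order; `Wd = C • E^{(d_K)}` with `#Sel₂(Wd) = 2` and clause (i) of `BSD(Wd,2)`
(`rank Wd = r_an Wd`). Then `rank E(ℚ) = 0` (GZK), `rank E(K) ≥ 1` (the point),
`rank E(K) = rank E(ℚ) + rank E^{(d_K)}(ℚ)` (`mordellWeilRank_baseChange_quadratic_holds`),
`rank Wd = rank E^{(d_K)}(ℚ)` (`mordellWeilRank_variableChange_holds`) and `rank Wd ≤ 1`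
(`mordellWeilRank_le_one_of_card_selmerGroup_two`) give `r_an(Wd) = rank Wd = 1`.
[cite: Darmon2004, Thm. 3.22] [cite: SilvermanAEC2009, Thm. X.4.2(a)] -/
theorem analyticRank_twin_eq_one_of_binders
    (W : WeierstrassCurve ℚ) [W.IsElliptic] [W.IsGloballyMinimal]
    (K : Type) [Field K] [NumberField K] (hGZK : rank_eq_analyticRank_of_analyticRank_le_one)
    (h2 : Module.finrank ℚ K = 2) (hr0 : W.analyticRank = 0)
    {P₀ : (W.baseChange K).toAffine.Point} (hPinf : ¬ IsOfFinAddOrder P₀)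
    (Wd : WeierstrassCurve ℚ) [Wd.IsElliptic]
    (hWd : ∃ C : WeierstrassCurve.VariableChange ℚ, C • W.quadraticTwist (NumberField.discr K : ℚ) = Wd)
    (hSel : Nat.card (Wd.selmerGroup 2) = 2) (hrk : Wd.mordellWeilRank = Wd.analyticRank) :
    Wd.analyticRank = 1 := by
  haveI hEK : (W.baseChange K).IsElliptic := isElliptic_baseChange' W K
  have hD0 : (NumberField.discr K : ℚ) ≠ 0 := by exact_mod_cast NumberField.discr_ne_zero K
  haveI hEt : (W.quadraticTwist (NumberField.discr K : ℚ)).IsElliptic :=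
    W.isElliptic_quadraticTwist hD0
  have hrankW : W.mordellWeilRank = 0 := by
    have h := (hGZK W (by rw [hr0]; exact zero_le_one)).1
    rw [h, hr0]
  have hK1 : 1 ≤ (W.baseChange K).mordellWeilRank :=
    one_le_mordellWeilRank_of_not_isOfFinAddOrder (W.baseChange K) hPinf
  have hsum := mordellWeilRank_baseChange_quadratic_holds W K h2
  have htw : Wd.mordellWeilRank = (W.quadraticTwist (NumberField.discr K : ℚ)).mordellWeilRank := by
    obtain ⟨C, hC⟩ := hWd
    rw [← hC]
    exact mordellWeilRank_variableChange_holds (W.quadraticTwist (NumberField.discr K : ℚ)) C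
  have hle : Wd.mordellWeilRank ≤ 1 := mordellWeilRank_le_one_of_card_selmerGroup_two Wd hSel
  omega

/-- **`ExactDescentAtTwo` MODULO FOUR PUBLISHED INPUTS** — Gross–Zagier AT THE ITEM'S TRIPLE
`(N_E, W, K)` (`hGZ`), Gross–Zagier–Kolyvagin over `ℚ` (`hGZK`), modularity (`hmod`), Milne 1972
Thm 1 any-model (`hMilneC`); Kolyvagin's theorem over `K` is NOT an input. For the rank-ZERO member:
`P(1)` descends to a non-torsion `P₀ ∈ E(K)` (`exists_heegnerPoint_map_eq_derivedPoint_one`); the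
twin has `r_an(Wd) = 1` by `analyticRank_twin_eq_one_of_binders` (uses `#Sel₂(Wd) = 2` and clause
(i) of `BSD(Wd,2)`); then `CMExactDescent.bsdp_two_of_card_sha_baseChange_eq_of_facts_rankZero`
(the CM-free symmetric exact descent: `ord₂ #Ш_an(W ⊗ K) = 2M₀ = ord₂ #Ш(W ⊗ K)` and Milne's
model-free descent) gives `BSD(W, 2)`. CONDITIONAL on the four named facts (none has a `_holds`).
[cite: GrossZagier1986, V.§2 (pp. 310–312)] [cite: Milne1972ArithmeticAV, §1 Thm. 1]
[cite: McCallumLMS1991, §5 Lemma 5.1] [cite: Miller2011LMS, Def. 1.1] -/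
theorem exactDescentAtTwo_of_four_facts
    (hGZ : ∀ (W : WeierstrassCurve ℚ) [NeZero (W.conductorNorm ℤ)] (K : Type) [Field K]
      [NumberField K], gross_zagier (W.conductorNorm ℤ) W K)
    (hGZK : rank_eq_analyticRank_of_analyticRank_le_one) (hmod : hasEntireLFunction_rat)
    (hMilneC : Milne1972.bsdQuotient_baseChange_quadratic_anyModel) :
    Summit.BirchSwinnertonDyer.BirchSwinnertonDyer.Theses.GenusKolyvaginAtTwo.ExactDescentAtTwo := by
  intro W _ _ _ _hcm hr0 hρ hT K _ _ hK hodd h3 hH Dt _hopt hc β ι d₁ hy M₀ hdiv hndiv hsha Wd _ _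
    hWd hSel hBd
  haveI hEK : (W.baseChange K).IsElliptic := isElliptic_baseChange' W K
  have h2 : Module.finrank ℚ K = 2 := hK.1
  have hρ2 : W.HasSurjectiveModNGaloisRep 2 := by
    simpa using hρ 1 one_pos
  -- the Heegner point `P₀ ∈ E(K)` below `P(1)` is non-torsion
  obtain ⟨P₀, Hd, hP₀, hP₀K⟩ := exists_heegnerPoint_map_eq_derivedPoint_one hK hH d₁
  have hPinf : ¬ IsOfFinAddOrder P₀ := by
    intro hfin
    apply hy
    rw [← hP₀K]
    exact (WeierstrassCurve.Affine.Point.map (W' := W)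
      (algebraMap K (ringClassField K ι 1)).toRatAlgHom).isOfFinAddOrder hfin
  -- the twin has analytic rank exactly one (binders + GZK, no Kolyvagin)
  have hrd : Wd.analyticRank = 1 :=
    analyticRank_twin_eq_one_of_binders W K hGZK h2 hr0 hPinf Wd hWd hSel hBd.1
  exact bsdp_two_of_card_sha_baseChange_eq_of_facts_rankZero W K Dt β ι d₁ Wd (hGZ W K) hGZK hmod
    hMilneC hρ2 hT hr0 hK hodd h3 hH hc hdiv hndiv hsha hWd hrd hBd

/-- **The crux RELATIVE TO the four-fact bundle of the CM sibling** — verbatim the antecedent of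
`CMExactDescent.cmExactDescentAtTwo_ofFacts` (item 22837):
`(∀ N W K, gross_zagier N W K) ∧ GZK ∧ modularity ∧ Milne any-model → ExactDescentAtTwo`. One
`…OfFacts` antecedent now serves both routes' descent cruxes. [cite: Miller2011LMS, Def. 1.1] -/
theorem exactDescentAtTwo_ofFourFacts :
    ((∀ (N : ℕ) [NeZero N] (W : WeierstrassCurve ℚ) (K : Type) [Field K] [NumberField K],
        gross_zagier N W K) ∧
      rank_eq_analyticRank_of_analyticRank_le_one ∧ hasEntireLFunction_rat ∧
      Milne1972.bsdQuotient_baseChange_quadratic_anyModel) →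
    Summit.BirchSwinnertonDyer.BirchSwinnertonDyer.Theses.GenusKolyvaginAtTwo.ExactDescentAtTwo :=
  fun h ↦ exactDescentAtTwo_of_four_facts (fun W _ K _ _ ↦ h.1 _ W K) h.2.1 h.2.2.1 h.2.2.2


/-! ## Append 1 (same seat): the curried closer and the line's leaf modulo print -/

/-- **The four-fact closer in the CM sibling's CURRIED binder shape** (`cmExactDescentAtTwo_of_facts`:
`hGZ : ∀ N W K, gross_zagier N W K`, then GZK, modularity, Milne any-model), for a by-name closer of an
`…OfFacts` restatement typed with Gross–Zagier quantified over all levels `N`.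
[cite: Miller2011LMS, Def. 1.1] -/
theorem exactDescentAtTwo_of_four_facts'
    (hGZ : ∀ (N : ℕ) [NeZero N] (W : WeierstrassCurve ℚ) (K : Type) [Field K] [NumberField K],
      gross_zagier N W K)
    (hGZK : rank_eq_analyticRank_of_analyticRank_le_one) (hmod : hasEntireLFunction_rat)
    (hMilneC : Milne1972.bsdQuotient_baseChange_quadratic_anyModel) :
    Summit.BirchSwinnertonDyer.BirchSwinnertonDyer.Theses.GenusKolyvaginAtTwo.ExactDescentAtTwo :=
  exactDescentAtTwo_of_four_facts (fun W _ K _ _ ↦ hGZ _ W K) hGZK hmod hMilneC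

/-- **THE LINE'S LEAF MODULO PRINT.** Granted the four published facts (bundle of
`exactDescentAtTwo_ofFourFacts`), crux #4 `ExactDescentAtTwo` drops out of the route's deciding
theorem `closes`: the registered leaf `Rank1Residual.NonCMAtTwo` (rung K4) follows from crux #2
`GenusPrimitiveSupplyAtTwo`, crux #3 `KolyvaginExactAtTwo`, the residual #5
`OffHabitatResidualAtTwo` and crux #6 `MinimalTwinBSDTwo` alone — the line's open content is
{supply, exactness at `2`, the twin's `BSD₂`, the off-habitat residual}. CONDITIONAL (credits
nothing; every antecedent is an open item or a named fact); BSD is not proved by this.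
[cite: Miller2011LMS, Def. 1.1] -/
theorem nonCMAtTwo_of_four_facts_of_cruxes
    (hfacts : (∀ (N : ℕ) [NeZero N] (W : WeierstrassCurve ℚ) (K : Type) [Field K] [NumberField K],
        gross_zagier N W K) ∧
      rank_eq_analyticRank_of_analyticRank_le_one ∧ hasEntireLFunction_rat ∧
      Milne1972.bsdQuotient_baseChange_quadratic_anyModel)
    (hP : Summit.BirchSwinnertonDyer.BirchSwinnertonDyer.Theses.GenusKolyvaginAtTwo.GenusPrimitiveSupplyAtTwo)
    (hX : Summit.BirchSwinnertonDyer.BirchSwinnertonDyer.Theses.GenusKolyvaginAtTwo.KolyvaginExactAtTwo)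
    (hR : Summit.BirchSwinnertonDyer.BirchSwinnertonDyer.Theses.GenusKolyvaginAtTwo.OffHabitatResidualAtTwo)
    (hTw : Summit.BirchSwinnertonDyer.BirchSwinnertonDyer.Theses.GenusKolyvaginAtTwo.MinimalTwinBSDTwo) :
    Summit.BirchSwinnertonDyer.BirchSwinnertonDyer.Rank1Residual.NonCMAtTwo := by
  -- proof revised 2026-08-28 (same seat, gen 4) for route rev 5, where the deciding theorem `closes`
  -- takes NINE binders (`hP hX hGf hR hTw hL hGZ hGZK hMi`: the third is the `…OfFourFacts` twin,
  -- item 24238, i.e. `exactDescentAtTwo_ofFourFacts` itself; the last four are the head-constant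
  -- facts, i.e. the components of `hfacts`); statement unchanged.
  -- (buildfix 2026-08-28, rev ≥ 6) `closes` now takes the LINE-6 split of `KolyvaginExactAtTwo` (binder
  -- `KolyvaginExactAtTwoOfSplitR` + Q1…Q5) and DERIVES `hX` from it before running the unchanged chain; this
  -- accepted statement keeps `KolyvaginExactAtTwo` itself, so the chain after that derivation is inlined here.
  obtain ⟨hGZ, hGZK, hL, hMi⟩ := hfacts
  have hG : Summit.BirchSwinnertonDyer.BirchSwinnertonDyer.Theses.GenusKolyvaginAtTwo.ExactDescentAtTwo :=
    exactDescentAtTwo_ofFourFacts ⟨hGZ, hGZK, hL, hMi⟩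
  intro W _ _ hcm hr
  haveI : NeZero (W.conductorNorm ℤ) := ⟨(W.conductorNorm_pos_holds).ne'⟩
  by_cases hH : (W.analyticRank = 0 ∧ (∀ n : ℕ, 0 < n → W.HasSurjectiveModNGaloisRep ((2 : ℤ) ^ n)) ∧
        Odd W.tamagawaProduct ∧
        ∃ Dt : Literature.NumberTheory.EllipticCurves.ModularForms.ModularParametrizationData W (W.conductorNorm ℤ),
          (∀ z ∈ Dt.L.lattice, ∃ w ∈ Literature.NumberTheory.EllipticCurves.ModularForms.periodLattice Dt.f,
            z = (Dt.c : ℂ) * w) ∧ Odd Dt.c)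
  · obtain ⟨hr0, hρ, hT, hopt⟩ := hH
    obtain ⟨K, _, _, hIQ, hodd, h3, hHe, hsq1, hsq2, Dt, β, ι, d₁, hoptDt, hc, hy, M₀, hdiv, hndiv,
      n, d, hn, hKoly, hPn, Wd, _, _, hWd, hcmd, hrd, hSel⟩ := hP W hcm hr0 hρ hT hopt
    have hex := hX W hcm K hIQ hodd h3 hHe hsq1 hsq2 hρ Dt β ι d₁ hy M₀ hdiv hndiv n d hn hKoly hPn
    have hBd : Literature.NumberTheory.EllipticCurves.BSDp Wd 2 := hTw Wd hcmd hrd hSel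
    exact hG W hcm hr0 hρ hT K hIQ hodd h3 hHe Dt hoptDt hc β ι d₁ hy M₀ hdiv hndiv hex Wd hWd hSel hBd
  · exact hR W hcm hr hH

end Summit.BirchSwinnertonDyer.BirchSwinnertonDyer.Theorems.GenusExactDescent

end
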